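import Mathlib
import Summits.ResolutionOfSingularities.ResolutionOfSingularities.Theorems.HomologicalConductorPersistenceHypersurfaceJacobian
import Literature.RingTheory.CohomologyAnnihilator.Localization
import HarnessLib

/-!
# `(x, t, z²) ⊆ ca⁴` for the `A₂ × line` stage `k[x,t,u][z]/(z³ - xt)` (characteristic `≠ 3`)

Crux `HomologicalConductor.Persistence` (stmt-ResolutionOfSingularities-16484), chain W4.4b. `[OURS · L1 w44b]`
— the "⊇" half of Step 1 of res-L1-w44b-stub-2's KILL-CANDIDATE-A2xLine ("`ca(T₀) ⊇ (x, t, z²)` by the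
Jacobian / matrix-factorisation homotopy", `T₀ = k[x,t,z,u]_𝔪/(xt - z³)`), obtained as an INSTANCE of
the Lean hypersurface Jacobian criterion `Theorems/HomologicalConductorPersistenceHypersurfaceJacobian.lean`
(p485630: `(n zⁿ⁻¹, ∂F/∂xᵢ)·B ⊆ caᵈ⁺¹(k[x₁,…,x_d][z]/(zⁿ + F))`): here `d = 3`, `n = 3`,
`F = -x t ∈ k[x, t, u]` (variables `X 0 = x`, `X 1 = t`, `X 2 = u`), so the Jacobian ideal is
`(3z², -t, -x, 0)`, which contains `x`, `t` and — when `3` is invertible in `k` — `z²`. NOT a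
statement of the manuscript under review; AI-drafted (weaker than expert review).

* `a2Line_span_le` — in `B = k[x,t,u][z]/(z³ - xt)`: `(x, t, z²)·B ⊆ ca⁴(B)` if `(3 : k) ≠ 0`;
* `a2Line_span_map_le` — the same after any localisation `B → L` (e.g. at the origin: the chain's
  `T₀`), via `map_cohomologyAnnihilatorOfDegree_le_of_isLocalization`.

Deliberately NOT here: the EQUALITY `ca(T₀) = (x, t, z²)·T₀` (its "⊆" half is the Knörrer
matrix-factorisation computation of the kill-candidate file, negative direction), and the next tower
stage `(1/3(1,1)) × line`.
-/

-- single-problem summit: the doubled namespace component is forced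
set_option linter.dupNamespace false

noncomputable section

open Polynomial

universe u

namespace Summit.ResolutionOfSingularities.ResolutionOfSingularities.Theorems.HomologicalConductor.PersistenceA2LineJacobian

open Literature.RingTheory.CohomologyAnnihilator
open Summit.ResolutionOfSingularities.ResolutionOfSingularities.Theorems.HomologicalConductor.PersistenceHypersurfaceJacobian

/-- **`(x, t, z²)·B ⊆ ca⁴(B)` for `B = k[x,t,u][z]/(z³ - xt)` when `3 ≠ 0` in `k`.** Instance of the
hypersurface Jacobian criterion (`mvPolynomial_span_jacobian_le` with `d = 3`, `n = 3`, `F = -xt`): the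
Jacobian ideal `(3z², ∂F/∂x, ∂F/∂t, ∂F/∂u) = (3z², -t, -x, 0)` lies in `ca⁴(B)` and contains `x`, `t`,
`z² = 3⁻¹ · 3z²`. [folklore] -/
theorem a2Line_span_le (k : Type u) [Field k] (h3 : (3 : k) ≠ 0) :
    Ideal.span
        {algebraMap (MvPolynomial (Fin 3) k)
            (AdjoinRoot (X ^ 3 + C (-(MvPolynomial.X 0 * MvPolynomial.X 1)) :
              (MvPolynomial (Fin 3) k)[X])) (MvPolynomial.X 0),
          algebraMap (MvPolynomial (Fin 3) k)
            (AdjoinRoot (X ^ 3 + C (-(MvPolynomial.X 0 * MvPolynomial.X 1)) :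
              (MvPolynomial (Fin 3) k)[X])) (MvPolynomial.X 1),
          AdjoinRoot.root (X ^ 3 + C (-(MvPolynomial.X 0 * MvPolynomial.X 1)) :
              (MvPolynomial (Fin 3) k)[X]) ^ 2} ≤
      cohomologyAnnihilatorOfDegree
        (AdjoinRoot (X ^ 3 + C (-(MvPolynomial.X 0 * MvPolynomial.X 1)) :
          (MvPolynomial (Fin 3) k)[X])) 4 := by
  set S : Type u := MvPolynomial (Fin 3) k with hS
  set F : S := -(MvPolynomial.X 0 * MvPolynomial.X 1) with hF
  set B : Type u := AdjoinRoot (X ^ 3 + C F : S[X]) with hB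
  have hJ := mvPolynomial_span_jacobian_le k 3 (n := 3) three_ne_zero F
  refine le_trans ?_ hJ
  rw [Ideal.span_le]
  -- the partial derivatives of `F = -xt`
  have hd0 : MvPolynomial.pderiv 0 F = -MvPolynomial.X 1 := by
    rw [hF, map_neg, (MvPolynomial.pderiv 0).leibniz, MvPolynomial.pderiv_X_self,
      MvPolynomial.pderiv_X_of_ne (show (1 : Fin 3) ≠ 0 by decide), smul_zero, zero_add, smul_eq_mul,
      mul_one]
  have hd1 : MvPolynomial.pderiv 1 F = -MvPolynomial.X 0 := by
    rw [hF, map_neg, (MvPolynomial.pderiv 1).leibniz, MvPolynomial.pderiv_X_self,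
      MvPolynomial.pderiv_X_of_ne (show (0 : Fin 3) ≠ 1 by decide), smul_zero, add_zero, smul_eq_mul,
      mul_one]
  rintro y (rfl | rfl | rfl)
  · -- `x = -∂F/∂t`
    have hx : algebraMap S B (MvPolynomial.X 0) = -algebraMap S B (MvPolynomial.pderiv 1 F) := by
      rw [hd1, map_neg (algebraMap S B) (MvPolynomial.X 0), neg_neg]
    rw [SetLike.mem_coe, hx, Ideal.neg_mem_iff]
    exact Ideal.subset_span (Set.mem_insert_of_mem _ ⟨1, rfl⟩)
  · -- `t = -∂F/∂x`
    have ht : algebraMap S B (MvPolynomial.X 1) = -algebraMap S B (MvPolynomial.pderiv 0 F) := by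
      rw [hd0, map_neg (algebraMap S B) (MvPolynomial.X 1), neg_neg]
    rw [SetLike.mem_coe, ht, Ideal.neg_mem_iff]
    exact Ideal.subset_span (Set.mem_insert_of_mem _ ⟨0, rfl⟩)
  · -- `z² = 3⁻¹ · (3 z²)`
    have hmem : ((3 : ℕ) : B) * AdjoinRoot.root (X ^ 3 + C F : S[X]) ^ (3 - 1) ∈
        Ideal.span (insert (((3 : ℕ) : B) * AdjoinRoot.root (X ^ 3 + C F : S[X]) ^ (3 - 1))
          (Set.range fun i : Fin 3 => algebraMap S B (MvPolynomial.pderiv i F))) :=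
      Ideal.subset_span (Set.mem_insert _ _)
    have h3B : algebraMap k B (3⁻¹ : k) * ((3 : ℕ) : B) = 1 := by
      rw [Nat.cast_ofNat, ← map_ofNat (algebraMap k B) 3, ← map_mul, inv_mul_cancel₀ h3, map_one]
    have h := Ideal.mul_mem_left _ (algebraMap k B (3⁻¹ : k)) hmem
    rw [← mul_assoc, h3B, one_mul] at h
    exact h

/-- **The same after localisation** (e.g. at the origin, the chain's local stage
`T₀ = (k[x,t,u][z]/(z³ - xt))_𝔪`): the image of `(x, t, z²)` lies in `ca⁴(L)` for every localisation
`L` of `B = k[x,t,u][z]/(z³ - xt)`, `char k ≠ 3`. [folklore] -/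
theorem a2Line_span_map_le (k : Type u) [Field k] (h3 : (3 : k) ≠ 0)
    (U : Submonoid (AdjoinRoot (X ^ 3 + C (-(MvPolynomial.X 0 * MvPolynomial.X 1)) :
      (MvPolynomial (Fin 3) k)[X])))
    (L : Type u) [CommRing L]
    [Algebra (AdjoinRoot (X ^ 3 + C (-(MvPolynomial.X 0 * MvPolynomial.X 1)) :
      (MvPolynomial (Fin 3) k)[X])) L]
    [IsLocalization U L] :
    (Ideal.span
        {algebraMap (MvPolynomial (Fin 3) k)
            (AdjoinRoot (X ^ 3 + C (-(MvPolynomial.X 0 * MvPolynomial.X 1)) :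
              (MvPolynomial (Fin 3) k)[X])) (MvPolynomial.X 0),
          algebraMap (MvPolynomial (Fin 3) k)
            (AdjoinRoot (X ^ 3 + C (-(MvPolynomial.X 0 * MvPolynomial.X 1)) :
              (MvPolynomial (Fin 3) k)[X])) (MvPolynomial.X 1),
          AdjoinRoot.root (X ^ 3 + C (-(MvPolynomial.X 0 * MvPolynomial.X 1)) :
              (MvPolynomial (Fin 3) k)[X]) ^ 2}).map (algebraMap _ L) ≤
      cohomologyAnnihilatorOfDegree L 4 :=
  (Ideal.map_mono (a2Line_span_le k h3)).trans
    (map_cohomologyAnnihilatorOfDegree_le_of_isLocalization U L 4)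

end Summit.ResolutionOfSingularities.ResolutionOfSingularities.Theorems.HomologicalConductor.PersistenceA2LineJacobian

end
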